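/-
Copyright (c) 2026 the pub-hodgecm2 formalisation cell (harness21).  New file, outside the frozen port manifest.
Origin: wall-breaker seat `prover-pub-hodgecm2-d2bridge-wb-8-g0-0` (WB-8, structural ∕ definitional route), 2026-08-23, on the
coordinator's re-point to ORIENTATION-MEMO v1.3 §4 **T2** (own-crow g93, `HOME/d2bridge/ORIENTATION-MEMO.md` d0e6440ee1308392).
AUDIT MODULE (evidence either way; theorems only, explicit binders, no `sorry`, no new definition, nothing cited anew).
HC_CM is NOT proved here; «Δ2 BRIDGE CLOSED» is NOT claimed; no pointer ∕ count ∕ hM token moves.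
-/
import Summits.HodgeConjecture.HodgeCM.Model.LiuDictionary
import Literature.NumberTheory.Automorphic.Liu2021.Thm418ProofMapRational
import HarnessLib

set_option autoImplicit false

/-!
# Δ2 bridge, orientation audit T2 — the EXACT typed reduction «`Thm418C` + T1 + (D) ⟹ the identity-component restriction of every
# block vector vanishes», and why the displayed (c)+(d) family cannot supply (D)

ORIENTATION-MEMO §3.1 runs the chain (C) `span (cmClasses K i) ⊆ F¹` (= test T1) + (D) «`block i ⊆ H^{0,1}`» + (E) algebra ⟹ `block i = ⊥`
at every `PhiMu` line, and §4 T2 asks whether the kernel can run it FROM THE DISPLAYED FAMILY of tonight's END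
({`hLiu'`, Ω-pin, `M ∕ jH ∕ hjHinj ∕ hjH`, `pieces`, `hnvD`, `h413`}, which the plug `PinSignatures.thm418C_liuDictionaryPin_of_pins` turns into
`Thm418C` of the pinned dictionary).

This file records the answer in typed form:

* §1 `res_eq_zero_of_thm418Combined_of_opposedTypes` — over ANY `LiuAlbaneseModuleDatum` `D`, restriction family `res`, generator sets
  `cmCl` and two families of subspaces `F1 K`, `F0bar K` of the targets: `Thm418Combined res cmCl` + (T1-shape) `span (cmCl K μ) ≤ F1 K` +
  (D-shape) `res K x ∈ F0bar K` for `K`-fixed `x ∈ block μ` + `Disjoint (F1 K) (F0bar K)` ⟹ `∃ K₀, ∀ K ≤ K₀`, `res K x = 0` on `(block μ)^K`.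
  Pure order ∕ linear algebra (15 lines).  `block μ = ⊥` itself needs, on top, the tower-separation law «`res K ∘ (g • ·)` detects every
  vector» — PROVED for the model tower in the companion `CorCM/D2Bridge/T2TowerSeparation.lean` (`ofTower_exists_fixedBy_res_ne_zero`),
  which also gives the `hsep`-free contradiction `ofTower_false_of_hodgeTypes_of_block_ne_bot` at every dictionary built from the tower.
* §2 `liuDictionary_res_block_eq_zero_of_hodgeTypes` — §1 AT THE MODEL: `W K := U.CohC (U.pms L ι₁ V K) 1` with the universe's weight-one
  Hodge structure `U.hodge _ 1`, `F1 K := F¹`, `F0bar K := conj F¹`; disjointness is the structure's own axiom `isCompl_F_complexConj 1 1`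
  (weight-1 purity `F¹ ⊓ conj F¹ = ⊥`).  And `liuDictionary_false_of_hodgeTypes_of_res_ne_zero` — the shape of the INCONSISTENCY WITNESS T2 asks for:
  add ONE non-vanishing `K`-fixed block vector with `res K x ≠ 0` below every level ⟹ `False`.
* §3 `oscImage_ne_bot_of_display` ∕ `block_ne_bot_of_display` — the OTHER half, over the abstract binders of the resolved increment: the
  displayed `hLiu : Thm418AsPrinted D` (its `ℂ[G]`-iso `Φ`), the Ω-pin `e ∕ he` at one admissible `a` (`j := σ a`), the J record
  `M ∕ jH ∕ hjHinj ∕ hjH` and `hnvD` at `j` give an INJECTIVE `ℂ[G]`-map `T.Ω μ a → T.H` (`jH ∘ (4.3) ∘ Φ⁻¹ ∘ lof_j ∘ e`; (4.3) injective by the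
  tree's `Map43RationalData.injective_J`), so `block μ ≠ ⊥`: the by-name family EXCLUDES «`block i = ⊥`» at every good line with an automorphic
  character.  `false_of_display_of_opposedTypes` joins §1 and §3: {display} + T1 + (D) + tower separation `hsep` ⟹ `False` — the typed form of
  the memo's §0.4, with (D) (and the J1-style `hsep`) the only inputs that are neither displayed nor tree theorems today.

WHAT THE KERNEL CAN AND CANNOT SUPPLY (first-hand type audit, tree paths as of 2026-08-23T21:30Z):
* `h418 : T.Thm418C` — supplied (by name tonight; by the plug from the displayed family).
* `hT1` (type (1,0) of the CM pull-back classes `geomClass K d f = (pull f 1).baseChange ℂ d.α`, `d` admissible) — DERIVABLE: `d.α` lies in the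
  `d.τ`-eigenline (`LiuCMSide.α_mem`), `d.isRealisation : IsCMTypeRealisation …` types eigenlines, `adm i d = d.IsReflexOfTypeG ι₁ Φ_{μ_i}` + `PhiMu i`
  give `d.τ ∈ d.ΦA` (own-crow `tau_mem_cmType_of_isReflexOfType`), and `pull` preserves `F¹` (`ModelAxiomsPerL.pull_hodge`).  = test T1 (wb-6 ∕ wb-7).
* `hD` (type (0,1) of `res K (block i)^K`) — NOT SUPPLIED BY ANY DISPLAYED BINDER, and not derivable from them: every carrier through which `jH`
  factors is Hodge-blind BY TYPE —
  `Map43RationalData.HB ∕ U ∕ L : Type` (abstract fields, `Liu2021/Thm418ProofMapRational.lean` :79–:109; the record's only orientation datum is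
  the free field `τ'_mem : τ' ∈ Φ_μ`), `HcmPieces.AK ∕ XK ∕ CM ∕ Mor : Type` (abstract fields, `CorCM/D2Bridge/HcmPieces.lean` :74–:140; its laws
  `P_eq ∕ tower_eq ∕ geom_eq ∕ geom_mem` place `res K ∘ jH ∘ M.ι ∘ (M.P φ ⊗ ℂ)` INSIDE `cmClasses K i`, i.e. on the `F¹` side — consistent with T1,
  never opposed to it), `Tower … V = Module.DirectLimit (towerLevel …)` (`Model/TowerCarrier.lean` :118; a `ℂ[G]`-module, no `HodgeStructure`),
  `block μ := ⨆ a, oscImage ⟨μ,a⟩` (`Literature/AlbaneseUnitaryShimuraModules.lean` :113–:123; isotypic part, Hodge-free by definition);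
  `Thm418AsPrinted D` (`Liu2021/Thm418AsPrinted.lean` :421–:435) is an isomorphism `ℂ ⊗ Ω(μ) ≃ ⊕ ω(μ,ε,χ)` of `ℂ[G]`-modules + items (1)–(3):
  no cohomology, no Hodge filtration.  The ONLY Hodge-typed objects in the whole family are the targets `U.CohC (U.pms L ι₁ V K) 1`
  (via `U.hodge`) and the CM records' `d.A` (via `d.isRealisation`), and the only displayed route into them is `cmClasses` — the (1,0) side.
  (D) is Liu's Prop. 4.13 ∕ (4.2) ∕ Thm. 4.18 read GEOMETRICALLY at the tree's pin `τ' = ῑ₁`; it enters the tree only BY VALUE (a J record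
  at `ῑ₁` whose `jH` is a Betti pull-back of typed classes) — memo §7 (iii).
* `hnv` — a non-zero identity-component restriction of a `K`-fixed vector of ONE `PhiMu` block at arbitrarily small `K`: the theta classes of
  record give `res cf = ω` with `ofLevel cf ∈ ⨆ j ∈ T, block j` (`ThetaAdelicSide.hJ_slot_*`), not yet single-block ∕ `K`-fixed ∕ `≠ 0` in this shape.
CONCLUSION (T2): no inconsistency witness is derivable in the kernel from the by-name display + T1; the display is type-consistent exactly
because `jH`'s source, the tower, `block`, and `HcmPieces`' carriers carry no Hodge structure — the orientation clash of the memo lives in the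
SEMANTICS of `hLiu'` + `pieces` (existence of an inhabitant over the tree's actual geometry), testable only by value.
-/

noncomputable section

open scoped TensorProduct DirectSum

namespace Summit.HodgeConjecture.CorCM.D2Bridge

open NumberField
open HodgeCM HodgeCM.Literature.Theta HodgeCM.Literature.Theta.LiuAlbaneseModuleDatum
open Literature.AlgebraicGeometry.Motives Literature.AlgebraicGeometry.Motives.HodgeStructure

universe u v w

/-! ## §1  The reduction over an abstract Albanese-module datum -/

/-- **T2, typed, abstract form.**  For a Liu Albanese-module datum `D` with restrictions `res K : H → W K` and generator sets `cmCl K μ`: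
the combined reading `Thm418Combined res cmCl` ([Liu21, Thm. 4.18 + (4.3) + (1)], the body of `LiuDictionary.Thm418C`), a (1,0)-type bound
`span (cmCl K μ) ≤ F1 K` (test T1's shape), a (0,1)-type statement `res K x ∈ F0bar K` for the `K`-fixed vectors of `block μ` (the memo's (D),
AS A HYPOTHESIS), and disjointness `F1 K ⊓ F0bar K = ⊥` (weight-one purity) force `res K x = 0` on `(block μ)^K` for all `K` below Thm. 4.18 (1)'s
threshold.  Pure order algebra; `block μ = ⊥` would need tower separation on top. [folklore] -/
theorem res_eq_zero_of_thm418Combined_of_opposedTypes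
    {G : Type u} [Group G] {Lvl : Type v} [Preorder Lvl] {Kof : Lvl → Subgroup G} (D : LiuAlbaneseModuleDatum G Kof)
    {W : Lvl → Type w} [∀ K, AddCommGroup (W K)] [∀ K, Module ℂ (W K)]
    (res : ∀ K : Lvl, D.H →ₗ[ℂ] W K) (cmCl : ∀ K : Lvl, D.Char → Set (W K))
    (F1 F0bar : ∀ K : Lvl, Submodule ℂ (W K))
    (h418 : D.Thm418Combined res cmCl)
    (hT1 : ∀ (K : Lvl) (μ : D.Char), Submodule.span ℂ (cmCl K μ) ≤ F1 K)
    (hdisj : ∀ K : Lvl, Disjoint (F1 K) (F0bar K))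
    (μ : D.Char) (hμ : D.PhiMu μ)
    (hD : ∀ (K : Lvl), ∀ x ∈ D.block μ, x ∈ fixedBy (Kof K) D.H → res K x ∈ F0bar K) :
    ∃ K₀ : Lvl, ∀ K ≤ K₀, ∀ x ∈ D.block μ, x ∈ fixedBy (Kof K) D.H → res K x = 0 := by
  obtain ⟨K₀, hK₀⟩ := h418 μ hμ
  refine ⟨K₀, fun K hK x hx hfix => ?_⟩
  have h1 : res K x ∈ F1 K := hT1 K μ (hK₀ K hK x hx hfix)
  have h0 : res K x ∈ F0bar K := hD K x hx hfix
  exact (hdisj K).le_bot (Submodule.mem_inf.2 ⟨h1, h0⟩)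

/-- **The witness shape.**  Under the same typed inputs, ONE `PhiMu` character `μ` with a `K`-fixed block vector of non-zero restriction below
every level is a contradiction.  (This is what an «inconsistency witness for the by-name display» would have to exhibit; of its four inputs only
`h418` is displayed and only `hT1` is tree-derivable — see the module docstring.) [folklore] -/
theorem false_of_thm418Combined_of_opposedTypes_of_res_ne_zero
    {G : Type u} [Group G] {Lvl : Type v} [Preorder Lvl] {Kof : Lvl → Subgroup G} (D : LiuAlbaneseModuleDatum G Kof)
    {W : Lvl → Type w} [∀ K, AddCommGroup (W K)] [∀ K, Module ℂ (W K)]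
    (res : ∀ K : Lvl, D.H →ₗ[ℂ] W K) (cmCl : ∀ K : Lvl, D.Char → Set (W K))
    (F1 F0bar : ∀ K : Lvl, Submodule ℂ (W K))
    (h418 : D.Thm418Combined res cmCl)
    (hT1 : ∀ (K : Lvl) (μ : D.Char), Submodule.span ℂ (cmCl K μ) ≤ F1 K)
    (hdisj : ∀ K : Lvl, Disjoint (F1 K) (F0bar K))
    (μ : D.Char) (hμ : D.PhiMu μ)
    (hD : ∀ (K : Lvl), ∀ x ∈ D.block μ, x ∈ fixedBy (Kof K) D.H → res K x ∈ F0bar K)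
    (hnv : ∀ K₀ : Lvl, ∃ K ≤ K₀, ∃ x ∈ D.block μ, x ∈ fixedBy (Kof K) D.H ∧ res K x ≠ 0) :
    False := by
  obtain ⟨K₀, hK₀⟩ := res_eq_zero_of_thm418Combined_of_opposedTypes D res cmCl F1 F0bar h418 hT1 hdisj μ hμ hD
  obtain ⟨K, hK, x, hx, hfix, hne⟩ := hnv K₀
  exact hne (hK₀ K hK x hx hfix)

/-! ## §2  At the model universe: `F1 := F¹`, `F0bar := conj F¹` of `U.hodge (U.pms L ι₁ V K) 1`, purity from `isCompl_F_complexConj` -/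

/-- Weight-one purity of the universe's Hodge structure on `H¹(P_Γ; ℚ)`: `F¹ ⊓ conj F¹ = ⊥` (Deligne, Hodge II, 1.2.5 with `p = q = 1`,
`p + q = n + 1` for `n = 1`) — an AXIOM FIELD of `HodgeStructure`, no cited fact. [folklore] -/
theorem disjoint_F_one_complexConj_F_one {M : Type u} [AddCommGroup M] [Module ℚ M] (H : HodgeStructure M 1) :
    Disjoint (H.F 1) (complexConj (H.F 1)) :=
  (H.isCompl_F_complexConj 1 1 (by norm_num)).disjoint

/-- **T2, typed, AT THE MODEL** (any real-carrier dictionary `T` at `(L, ι₁, V)`, in particular the pinned `liuDictionaryPin …`): from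
`T.Thm418C` (tonight's `h418` ∕ the plug's output), T1 in the form `span (T.cmClasses K μ) ≤ F¹ H¹(P_K)` and the memo's (D) in the form
«the identity-component restriction of every `K`-fixed vector of `block μ` is of type (0,1)» (`∈ conj F¹`), the restriction VANISHES on
`(block μ)^K` for every `K` below Thm. 4.18 (1)'s threshold.  The Hodge structure is the universe's `U.hodge (U.pms L ι₁ V K) 1`; purity is its
axiom.  `hD` is the input NO displayed binder of the (c)+(d) family supplies (module docstring). [folklore] -/
theorem liuDictionary_res_block_eq_zero_of_hodgeTypes
    (hHD : Literature.AlgebraicGeometry.HodgeTheory.exists_isReal_hodgeModel)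
    (hI : Literature.AlgebraicGeometry.HodgeTheory.hodgePQ_independent_of_hodgeModel)
    (h₁ : Literature.NumberTheory.Automorphic.PicardCM.BallQuotientUniformised)
    (h₃ : Literature.NumberTheory.Automorphic.PicardCM.CMAbelianVarietyRealised)
    {L : HodgeCM.CMField} {ι₁ : (L : Type) →+* ℂ} {V : HodgeCM.HermSpace3 L ι₁}
    (T : HodgeCM.Model.LiuDictionary hHD hI h₁ h₃ V) (h418 : T.Thm418C)
    (hT1 : ∀ (K : HodgeCM.Level V) (μ : T.Char), Submodule.span ℂ (T.cmClasses K μ) ≤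
      ((HodgeCM.Model.picardCMUniverse hHD hI h₁ h₃).hodge ((HodgeCM.Model.picardCMUniverse hHD hI h₁ h₃).pms L ι₁ V K) 1).F 1)
    (μ : T.Char) (hμ : T.PhiMu μ)
    (hD : ∀ (K : HodgeCM.Level V), ∀ x ∈ T.block μ, x ∈ fixedBy K.K T.H →
      T.res K x ∈ complexConj (((HodgeCM.Model.picardCMUniverse hHD hI h₁ h₃).hodge
        ((HodgeCM.Model.picardCMUniverse hHD hI h₁ h₃).pms L ι₁ V K) 1).F 1)) :
    ∃ K₀ : HodgeCM.Level V, ∀ K ≤ K₀, ∀ x ∈ T.block μ, x ∈ fixedBy K.K T.H → T.res K x = 0 :=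
  res_eq_zero_of_thm418Combined_of_opposedTypes T.toLiuAlbaneseModuleDatum T.res T.cmClasses
    (fun K => ((HodgeCM.Model.picardCMUniverse hHD hI h₁ h₃).hodge ((HodgeCM.Model.picardCMUniverse hHD hI h₁ h₃).pms L ι₁ V K) 1).F 1)
    (fun K => complexConj (((HodgeCM.Model.picardCMUniverse hHD hI h₁ h₃).hodge
      ((HodgeCM.Model.picardCMUniverse hHD hI h₁ h₃).pms L ι₁ V K) 1).F 1))
    h418 hT1 (fun _ => disjoint_F_one_complexConj_F_one _) μ hμ hD

/-- **The inconsistency-witness shape AT THE MODEL**: `T.Thm418C` + T1 + (D) + ONE `PhiMu` character with a `K`-fixed block vector of non-zero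
identity-component restriction below every level ⟹ `False`.  Of the four inputs, tonight's END displays only `h418` (by name); T1 is
tree-derivable; (D) and the non-vanishing input are not in the displayed family (module docstring) — which is the T2 report. [folklore] -/
theorem liuDictionary_false_of_hodgeTypes_of_res_ne_zero
    (hHD : Literature.AlgebraicGeometry.HodgeTheory.exists_isReal_hodgeModel)
    (hI : Literature.AlgebraicGeometry.HodgeTheory.hodgePQ_independent_of_hodgeModel)
    (h₁ : Literature.NumberTheory.Automorphic.PicardCM.BallQuotientUniformised)
    (h₃ : Literature.NumberTheory.Automorphic.PicardCM.CMAbelianVarietyRealised)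
    {L : HodgeCM.CMField} {ι₁ : (L : Type) →+* ℂ} {V : HodgeCM.HermSpace3 L ι₁}
    (T : HodgeCM.Model.LiuDictionary hHD hI h₁ h₃ V) (h418 : T.Thm418C)
    (hT1 : ∀ (K : HodgeCM.Level V) (μ : T.Char), Submodule.span ℂ (T.cmClasses K μ) ≤
      ((HodgeCM.Model.picardCMUniverse hHD hI h₁ h₃).hodge ((HodgeCM.Model.picardCMUniverse hHD hI h₁ h₃).pms L ι₁ V K) 1).F 1)
    (μ : T.Char) (hμ : T.PhiMu μ)
    (hD : ∀ (K : HodgeCM.Level V), ∀ x ∈ T.block μ, x ∈ fixedBy K.K T.H →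
      T.res K x ∈ complexConj (((HodgeCM.Model.picardCMUniverse hHD hI h₁ h₃).hodge
        ((HodgeCM.Model.picardCMUniverse hHD hI h₁ h₃).pms L ι₁ V K) 1).F 1))
    (hnv : ∀ K₀ : HodgeCM.Level V, ∃ K ≤ K₀, ∃ x ∈ T.block μ, x ∈ fixedBy K.K T.H ∧ T.res K x ≠ 0) :
    False :=
  false_of_thm418Combined_of_opposedTypes_of_res_ne_zero T.toLiuAlbaneseModuleDatum T.res T.cmClasses
    (fun K => ((HodgeCM.Model.picardCMUniverse hHD hI h₁ h₃).hodge ((HodgeCM.Model.picardCMUniverse hHD hI h₁ h₃).pms L ι₁ V K) 1).F 1)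
    (fun K => complexConj (((HodgeCM.Model.picardCMUniverse hHD hI h₁ h₃).hodge
      ((HodgeCM.Model.picardCMUniverse hHD hI h₁ h₃).pms L ι₁ V K) 1).F 1))
    h418 hT1 (fun _ => disjoint_F_one_complexConj_F_one _) μ hμ hD hnv


/-! ## §3  What the displayed family DOES force: the good blocks are NON-ZERO

The other half of the dichotomy, over the abstract binders of the resolved increment (`HcmPieces.thm418Combined_of_asPrinted_resolved`):
the cite `hLiu : Thm418AsPrinted D` (its `ℂ[G]`-isomorphism `Φ : ℂ ⊗ Ω(μ) ≃ ⊕ ω(μ,ε,χ)`), the Ω-pin `e ∕ he` at one admissible `a`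
(`T.Ω μ a ≃ ω_j` equivariantly, `j := σ a`), the J record `M` with `jH ∕ hjHinj ∕ hjH`, and `hnvD` at `j` give an INJECTIVE `ℂ[G]`-map
`T.Ω μ a → T.H` (`jH ∘ (4.3) ∘ Φ⁻¹ ∘ lof_j ∘ e`, (4.3) injective by the tree's `Map43RationalData.injective_J`), hence `oscImage ⟨μ,a⟩ ≠ ⊥` and
`block μ ≠ ⊥`.  So the by-name family already EXCLUDES «`block i = ⊥`» at every good `PhiMu` line with an automorphic character; joined to
§1–§2 this is the typed form of the memo's §0.4: {display} + T1 + (D) (+ tower separation) is contradictory — and of these only (D) is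
neither displayed nor in the tree. -/

section Display

variable {F E : Type} [Field F] [NumberField F] [IsTotallyReal F] [Field E] [NumberField E] [Algebra F E]
  [IsTotallyComplex E] [Algebra.IsQuadraticExtension F E]

open Literature.NumberTheory.Automorphic.Liu2021 Literature.NumberTheory.Automorphic.Liu2021.Thm418Data

/-- Transport of the `G`-action through the inverse of [Liu21, Thm. 4.18]'s isomorphism on ONE summand: `Φ⁻¹ (lof_j (g · y)) = (g ⊗ 1) · Φ⁻¹ (lof_j y)`.
[cite: Liu2021, Thm. 4.18 (l. 2233–2237)] -/
theorem symm_lof_rhoAt (D : Thm418Data F E) [DecidableEq D.AdmIndex]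
    (Φ : (ℂ ⊗[fieldOfValues E D.μ] D.Ω) ≃ₗ[ℂ] (⨁ i : D.AdmIndex, D.omegaAt i))
    (hΦ : ∀ (g : D.G) (x : ℂ ⊗[fieldOfValues E D.μ] D.Ω) (i : D.AdmIndex), Φ ((D.rhoΩ g).baseChange ℂ x) i = D.rhoAt i g (Φ x i))
    (j : D.AdmIndex) (g : D.G) (y : D.omegaAt j) :
    Φ.symm (DirectSum.lof ℂ D.AdmIndex D.omegaAt j (D.rhoAt j g y)) =
      (D.rhoΩ g).baseChange ℂ (Φ.symm (DirectSum.lof ℂ D.AdmIndex D.omegaAt j y)) := by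
  apply Φ.injective
  rw [LinearEquiv.apply_symm_apply]
  refine DFinsupp.ext fun i => ?_
  rw [hΦ, LinearEquiv.apply_symm_apply, DirectSum.lof_eq_of, DirectSum.lof_eq_of]
  by_cases hij : i = j
  · subst hij
    rw [DirectSum.of_eq_same, DirectSum.of_eq_same]
  · rw [DirectSum.of_eq_of_ne j i _ hij, DirectSum.of_eq_of_ne j i _ hij, map_zero]

/-- **The displayed family forces `oscImage ⟨μ, a⟩ ≠ ⊥`.**  Inputs, all by name in tonight's END or tree theorems: `hLiu` [Thm. 4.18 as printed],
the Ω-pin `e ∕ he` at `a` (X3-ω), the J record `M` with `jH ∕ hjHinj ∕ hjH` (X1), `hnv` [Lem. D.1 (1)] at `j`, and `H¹_{B,τ'}(A_μ, ℚ)` finite over `ℚ`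
(an `M_μ`-line).  The map `jH ∘ (4.3) ∘ Φ⁻¹ ∘ lof_j ∘ e : T.Ω μ a → T.H` is `ℂ[G]`-linear and injective, and its range lies in `oscImage ⟨μ,a⟩`.
[cite: Liu2021, Thm. 4.18 with proof (4.3) (l. 2232–2268)] -/
theorem oscImage_ne_bot_of_display (D : Thm418Data F E)
    {Lvl : Type v} {Kof : Lvl → Subgroup D.G} (T : LiuAlbaneseModuleDatum D.G Kof)
    (hLiu : Thm418AsPrinted D) (μ : T.Char) (a : T.Adm μ) (j : D.AdmIndex)
    (e : T.Ω μ a ≃ₗ[ℂ] D.omegaAt j)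
    (he : ∀ (g : D.G) (m : T.Ω μ a), e (MonoidAlgebra.of ℂ D.G g • m) = D.rhoAt j g (e m))
    (M : D.Map43RationalData) [Module.Finite ℚ M.L]
    (jH : M.HB →ₗ[ℂ] T.H) (hjHinj : Function.Injective jH)
    (hjH : ∀ (g : D.G) (x : M.HB), jH (M.ρB g x) = MonoidAlgebra.of ℂ D.G g • jH x)
    (hnv : Nontrivial (D.omegaAt j)) :
    T.oscImage ⟨μ, a⟩ ≠ ⊥ := by
  classical
  obtain ⟨Φ, hΦ, -, -, -⟩ := hLiu
  -- the composite `ψ₀ = jH ∘ J ∘ Φ⁻¹ ∘ lof_j ∘ e`, `ℂ`-linear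
  let ψ₀ : T.Ω μ a →ₗ[ℂ] T.H :=
    jH ∘ₗ M.toMap43Data.J ∘ₗ Φ.symm.toLinearMap ∘ₗ DirectSum.lof ℂ D.AdmIndex D.omegaAt j ∘ₗ e.toLinearMap
  have hψ₀ : ∀ m, ψ₀ m = jH (M.toMap43Data.J (Φ.symm (DirectSum.lof ℂ D.AdmIndex D.omegaAt j (e m)))) := fun _ => rfl
  -- it is `G`-equivariant
  have hcomm : ∀ (g : D.G) (m : T.Ω μ a),
      ψ₀ (MonoidAlgebra.single g (1 : ℂ) • m) = MonoidAlgebra.single g (1 : ℂ) • ψ₀ m := by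
    intro g m
    rw [hψ₀, hψ₀, ← MonoidAlgebra.of_apply, he, symm_lof_rhoAt D Φ hΦ j g (e m), M.hJ, ← hjH]
  let ψ : T.Ωt ⟨μ, a⟩ →ₗ[MonoidAlgebra ℂ D.G] T.H := MonoidAlgebra.equivariantOfLinearOfComm ψ₀ hcomm
  have hψ : ∀ m, ψ m = ψ₀ m := fun _ => rfl
  -- it is injective
  have hinj : Function.Injective ψ := by
    intro m m' hmm'
    rw [hψ, hψ, hψ₀, hψ₀] at hmm'
    have h1 := Φ.symm.injective (M.injective_J (hjHinj hmm'))
    have h2 : e m = e m' := by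
      have := congrArg (fun x : ⨁ i : D.AdmIndex, D.omegaAt i => x j) h1
      simpa only [DirectSum.lof_eq_of, DirectSum.of_eq_same] using this
    exact e.injective h2
  -- a non-zero vector of `ω_j` gives a non-zero vector of the range
  intro hbot
  obtain ⟨y, hy⟩ := exists_ne (0 : D.omegaAt j)
  have hm : e.symm y ≠ 0 := fun h => hy (by simpa using congrArg e h)
  have hmem : ψ (e.symm y) ∈ T.oscImage ⟨μ, a⟩ :=
    range_le_oscImage (D := T) ⟨μ, a⟩ ψ ⟨e.symm y, rfl⟩
  rw [hbot, Submodule.mem_bot] at hmem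
  exact hm (hinj (hmem.trans (map_zero ψ).symm))

/-- … hence **`block μ ≠ ⊥`** under the same displayed inputs. [cite: Liu2021, Thm. 4.18 with proof (4.3) (l. 2232–2268)] -/
theorem block_ne_bot_of_display (D : Thm418Data F E)
    {Lvl : Type v} {Kof : Lvl → Subgroup D.G} (T : LiuAlbaneseModuleDatum D.G Kof)
    (hLiu : Thm418AsPrinted D) (μ : T.Char) (a : T.Adm μ) (j : D.AdmIndex)
    (e : T.Ω μ a ≃ₗ[ℂ] D.omegaAt j)
    (he : ∀ (g : D.G) (m : T.Ω μ a), e (MonoidAlgebra.of ℂ D.G g • m) = D.rhoAt j g (e m))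
    (M : D.Map43RationalData) [Module.Finite ℚ M.L]
    (jH : M.HB →ₗ[ℂ] T.H) (hjHinj : Function.Injective jH)
    (hjH : ∀ (g : D.G) (x : M.HB), jH (M.ρB g x) = MonoidAlgebra.of ℂ D.G g • jH x)
    (hnv : Nontrivial (D.omegaAt j)) :
    T.block μ ≠ ⊥ := by
  intro hbot
  refine oscImage_ne_bot_of_display D T hLiu μ a j e he M jH hjHinj hjH hnv (le_bot_iff.mp ?_)
  rw [← hbot]
  exact oscImage_le_block (D := T) ⟨μ, a⟩

/-- **THE TYPED DICHOTOMY (T2 in one statement).**  Over one datum: the display's `Thm418Combined` (via the plug), T1, (D), weight-one purity,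
and the display's own non-vanishing of the block (§3) are jointly contradictory AS SOON AS the restriction family detects the block
(`hsep`: a non-zero `K`-fixed… — stated here as the separation input «`block μ ≠ ⊥ →` some `K`-fixed block vector restricts non-trivially below
every level», the J1 tower-separation law, NOT displayed).  Every input except (D) and `hsep` is displayed or tree-derivable.
[cite: Liu2021, Thm. 4.18 with proof (4.3) (l. 2232–2268)] -/
theorem false_of_display_of_opposedTypes (D : Thm418Data F E)
    {Lvl : Type v} [Preorder Lvl] {Kof : Lvl → Subgroup D.G} (T : LiuAlbaneseModuleDatum D.G Kof)
    {W : Lvl → Type w} [∀ K, AddCommGroup (W K)] [∀ K, Module ℂ (W K)]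
    (res : ∀ K : Lvl, T.H →ₗ[ℂ] W K) (cmCl : ∀ K : Lvl, T.Char → Set (W K))
    (F1 F0bar : ∀ K : Lvl, Submodule ℂ (W K))
    (h418 : T.Thm418Combined res cmCl)
    (hT1 : ∀ (K : Lvl) (μ : T.Char), Submodule.span ℂ (cmCl K μ) ≤ F1 K)
    (hdisj : ∀ K : Lvl, Disjoint (F1 K) (F0bar K))
    (μ : T.Char) (hμ : T.PhiMu μ)
    (hD : ∀ (K : Lvl), ∀ x ∈ T.block μ, x ∈ fixedBy (Kof K) T.H → res K x ∈ F0bar K)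
    (hsep : T.block μ ≠ ⊥ → ∀ K₀ : Lvl, ∃ K ≤ K₀, ∃ x ∈ T.block μ, x ∈ fixedBy (Kof K) T.H ∧ res K x ≠ 0)
    (hLiu : Thm418AsPrinted D) (a : T.Adm μ) (j : D.AdmIndex)
    (e : T.Ω μ a ≃ₗ[ℂ] D.omegaAt j)
    (he : ∀ (g : D.G) (m : T.Ω μ a), e (MonoidAlgebra.of ℂ D.G g • m) = D.rhoAt j g (e m))
    (M : D.Map43RationalData) [Module.Finite ℚ M.L]
    (jH : M.HB →ₗ[ℂ] T.H) (hjHinj : Function.Injective jH)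
    (hjH : ∀ (g : D.G) (x : M.HB), jH (M.ρB g x) = MonoidAlgebra.of ℂ D.G g • jH x)
    (hnv : Nontrivial (D.omegaAt j)) :
    False :=
  false_of_thm418Combined_of_opposedTypes_of_res_ne_zero T res cmCl F1 F0bar h418 hT1 hdisj μ hμ hD
    (hsep (block_ne_bot_of_display D T hLiu μ a j e he M jH hjHinj hjH hnv))

end Display

end Summit.HodgeConjecture.CorCM.D2Bridge

end
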